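import Literature.NumberTheory.Rogawski1990.LocalTransfer                    -- ★ `stableOrbitalIntegralRel`, `classOrbitalIntegral`
import Literature.NumberTheory.Automorphic.OrbitalMeasureCanonical          -- ★ `OrbitalMeasureFamily.IsCanonical`
import Literature.MeasureTheory.Group.InvariantQuotientScaling              -- ★ `quotientMeasure_smul_measure`
import Mathlib.MeasureTheory.Integral.RieszMarkovKakutani.Real
import HarnessLib

/-!
# K2 · E4 · U1 #20 helper — SCALING of orbital measure families: `Φ(c, f; κ•m) = κ·Φ(c, f; m)`, canonical families for `κ•ν`, and `ν ∕ ρ = 0` for `ν = 0`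

Helper file for `Theorems/K2E4WeakMatrixAlmostEverywhereAgreement.lean` (socket `sig_K2E4WeakMatrixAlmostEverywhereAgreement` of
`Cruxes/H413/Lines/K2_E4_SingularTransferKappaSignSigsWeakMatrixRigidity.lean`, crux H413 = `stmt-HodgeConjecture-24833`, cell `pub/hodgecm-mathlib`,
Track B «K2-LIT», base K2E4-p20).  THEOREMS ONLY (no `def`, no instance, no notation, no `sorry`); pure measure-theoretic bookkeeping.

WHY.  The socket's frame fixes a Haar measure `νH_v` on `H_v = U(Φ₂)(L⁺_v) × U(Φ₁)(L⁺_v)` WITHOUT the normalisation `νH_v(K_{H,v}) = 1` under which the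
explicit unit fundamental lemma (★ `UnitFundamentalLemmaExplicit`) is stated; the proof of the socket rescales `νH_v ↦ λ_v⁻¹ • νH_v` (`λ_v = νH_v(K_{H,v})`) and
the canonical orbital measure family with it.  This file records how the tree's objects move under `m ↦ κ • m`:
* `classOrbitalIntegral_smul_family`, `stableOrbitalIntegralRel_smul_family` — orbital ∕ stable orbital integrals are linear in the family;
* `isCanonical_smul_family` — a family canonical for `ν` (★ `IsCanonical`: `m c = dν ∕ dt_c`) rescales to one canonical for `κ • ν` (★ `quotientMeasure_smul_measure`);
* `quotientMeasure_eq_zero_of_eq_zero` — the canonical quotient of the ZERO measure is `0` (so a canonical family with a non-zero member sits over a non-zero `ν`).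
[Rogawski1990 §1.7 p. 6 «compatible measures … `dg = c|Ω|_v`»; §4.3 (4.3.1) p. 43.]

HONEST LABEL: HC_CM is proved only modulo the 7 printed citations (2 remaining named inputs: hLiu418 = stmt-HodgeConjecture-24832,
h413 = stmt-HodgeConjecture-24833) until rung 0 closes; this file consumes nothing printed.
-/

set_option autoImplicit false
set_option linter.dupNamespace false

noncomputable section

open MeasureTheory Measure Topology
open Literature.NumberTheory.Rogawski1990 Literature.NumberTheory.Automorphic Literature.MeasureTheory.Group
open scoped NNReal ENNReal

namespace Summit.HodgeConjecture.HodgeConjecture.Cruxes.H413.K2E4WeakMatrixAlmostEverywhereAgreement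

/-! ## §1 Orbital and stable orbital integrals are linear in the family -/

section Family

variable {G : Type*} [Group G] [∀ γ : G, MeasurableSpace (G ⧸ Subgroup.centralizer ({γ} : Set G))]

/-- **`Φ(c, f; κ • m) = κ · Φ(c, f; m)`** (Mathlib `integral_smul_measure` through ★ `orbitalIntegral_smul_measure`). [cite: Rogawski1990, §1.7 p. 6] -/
theorem classOrbitalIntegral_smul_family (κ : ℝ≥0∞) (m : OrbitalMeasureFamily G) (f : G → ℂ) (c : ConjClasses G) :
    classOrbitalIntegral (fun c' => κ • m c') f c = (κ.toReal : ℂ) * classOrbitalIntegral m f c := by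
  rw [classOrbitalIntegral_eq, classOrbitalIntegral_eq, orbitalIntegral_smul_measure, Complex.real_smul]

/-- **`Φ^st(γ, f; κ • m) = κ · Φ^st(γ, f; m)`** for every «stable conjugacy» relation `st` (Mathlib `mul_finsum_mem`, no finiteness needed over `ℂ`).
[cite: Rogawski1990, §4.1 (4.1.1) p. 39] -/
theorem stableOrbitalIntegralRel_smul_family (st : G → G → Prop) (κ : ℝ≥0∞) (m : OrbitalMeasureFamily G) (f : G → ℂ) (γ : G) :
    stableOrbitalIntegralRel st (fun c' => κ • m c') f γ = (κ.toReal : ℂ) * stableOrbitalIntegralRel st m f γ := by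
  rw [stableOrbitalIntegralRel_def, stableOrbitalIntegralRel_def, mul_finsum_mem]
  exact finsum_mem_congr rfl fun c _ => classOrbitalIntegral_smul_family κ m f c

end Family

/-! ## §2 Canonical families rescale with the Haar measure; the quotient of the zero measure -/

section Canonical

variable {G : Type*} [Group G] [TopologicalSpace G] [IsTopologicalGroup G] [LocallyCompactSpace G] [SecondCountableTopology G]
  [T2Space G] [MeasurableSpace G] [BorelSpace G]
  [∀ γ : G, MeasurableSpace (G ⧸ Subgroup.centralizer ({γ} : Set G))]
  [∀ γ : G, BorelSpace (G ⧸ Subgroup.centralizer ({γ} : Set G))]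

/-- **A family canonical for `ν` rescales to a family canonical for `κ • ν`** (`0 < κ < ∞`): `κ • (dν ∕ dt_c) = d(κ•ν) ∕ dt_c` with the SAME normalised
centraliser measures `t_c` (★ `quotientMeasure_smul_measure`). [cite: Rogawski1990, §1.7 p. 6; §4.3 (4.3.1) p. 43] [cite: DeitmarEchterhoff2014, Thm. 1.5.3] -/
theorem isCanonical_smul_family {P : G → Prop} {ν : Measure G} [ν.IsHaarMeasure] [ν.IsMulRightInvariant] {m : OrbitalMeasureFamily G}
    (h : m.IsCanonical P ν) {κ : ℝ≥0∞} (hκ : κ ≠ 0) (hκ' : κ ≠ ⊤) :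
    haveI := IsHaarMeasure.smul ν hκ hκ'
    OrbitalMeasureFamily.IsCanonical P (κ • ν) (fun c => κ • m c) := by
  haveI := IsHaarMeasure.smul ν hκ hκ'
  intro c hc
  obtain ⟨t, ht, hti, h1, hm⟩ := h c hc
  refine ⟨t, ht, hti, h1, ?_⟩
  change κ • m c = _
  rw [hm]
  exact (quotientMeasure_smul_measure _ (isClosed_coe_centralizer_singleton (Quotient.out c)) t ν hκ hκ').symm

omit [∀ γ : G, MeasurableSpace (G ⧸ Subgroup.centralizer ({γ} : Set G))]
  [∀ γ : G, BorelSpace (G ⧸ Subgroup.centralizer ({γ} : Set G))] in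
/-- **The canonical quotient of the ZERO measure vanishes**: `quotientMeasure H ρ hH ν = 0` when `ν = 0` (its Riesz functional `F ↦ ∫ lift F dν` is `0`; regular
measures are determined by their integrals on `C_c`, Mathlib `Measure.ext_of_integral_eq_on_compactlySupported`). [cite: DeitmarEchterhoff2014, Thm. 1.5.3] -/
theorem quotientMeasure_eq_zero_of_eq_zero (H : Subgroup G) (hH : IsClosed (H : Set G)) [MeasurableSpace (G ⧸ H)] [BorelSpace (G ⧸ H)]
    (ρ : Measure H) [ρ.IsHaarMeasure] [ρ.IsInvInvariant] (ν : Measure G) [IsFiniteMeasureOnCompacts ν] [ν.IsMulRightInvariant] (hν : ν = 0) :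
    quotientMeasure H ρ hH ν = 0 := by
  haveI : IsClosed (H : Set G) := hH
  refine Measure.ext_of_integral_eq_on_compactlySupported fun F => ?_
  rw [integral_quotientMeasure, quotientFunctional_apply, integral_zero_measure]
  have h0 : ∫ x, liftCc H ρ hH F x ∂ν = 0 := by rw [hν, integral_zero_measure]
  exact h0

end Canonical

end Summit.HodgeConjecture.HodgeConjecture.Cruxes.H413.K2E4WeakMatrixAlmostEverywhereAgreement

end
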